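import Literature.NumberTheory.Transcendental.DeRhamTheorem
import Literature.Geometry.Kaehler.CechDeRham
import Literature.Geometry.Kaehler.ChartTransport
import Literature.AlgebraicTopology.SingularHomology.CechSingularBridge
import Literature.AlgebraicTopology.SingularHomology.CechDualityChartConvex
import Literature.Analysis.Convexity.SmallBallImages
import Mathlib.Geometry.Manifold.Metrizable
import Mathlib.Analysis.InnerProductSpace.EuclideanDist
import Mathlib.Topology.MetricSpace.Pseudo.Lemmas
import Mathlib.Topology.UniformSpace.HeineCantor
import HarnessLib

/-!
# de Rham's theorem (numerical form): chart-convex finite covers and compact manifolds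

Conclusion of the Čech route to de Rham's theorem `dim_ℝ H^k_dR(M; ℝ) = b_k(M; ℝ)`
(`Literature.NumberTheory.Transcendental.finrank_deRhamCohomology_eq_bettiNumber`, the named fact
of `DeRhamTheorem.lean`) for manifolds modelled on a finite-dimensional normed space `E` itself
(`I = 𝓘(ℝ, E)`, no boundary): A. Weil, *Sur les théorèmes de de Rham*, Comment. Math. Helv. 26
(1952) §§2–4; R. Bott, L. W. Tu, *Differential Forms in Algebraic Topology* (1982), Thm. 8.9 with
Thm. 15.8 ("for a good cover, `H_dR(M) ≅ Ȟ(𝔘; ℝ) ≅ H_sing(M; ℝ)`").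

Given a **chart-convex finite cover** `𝒰 : ChartConvexCover E M ι` — a finite open cover
`(U_i)` of `M` each of whose nonempty finite intersections `U_J` is, in some chart `chartAt E p`,
the preimage of an open convex subset of the chart target (for compact `M` such covers exist by
shrinking chart balls; that existence statement is a separate file) — we prove

* `ChartConvexCover.hgood` — every `U_J` is de Rham-acyclic in positive degrees (Poincaré lemma on
  chart-convex sets, `localClosedForms_chartSet_le_localExactForms`);
* `ChartConvexCover.exists_const` — closed `0`-forms on `U_J` are restrictions of constants
  (`eq_of_inChart_apply_eq_of_mem_localClosedForms_zero`);
* `ChartConvexCover.hacyc` — every `U_J` is acyclic for singular cochains with coefficients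
  `ULift ℝ` (chart sets of nonempty convex sets are contractible; empty ones have no chains);
* **`thetaEquiv`** — the Čech complexes of closed `0`-forms (`cechClosedδ`, de Rham side) and of
  singular `0`-cocycles (`cechZeroδ`, coefficients `ULift ℝ`) of such a cover are ISOMORPHIC: a
  closed `0`-form `α` on `U_J` goes to the `0`-cochain `σ ↦ α(σ.pt)`; this is natural for
  restriction, injective always, a cocycle because `α` is constant on `U_J`, and onto the
  `0`-cocycles because these are the multiples of the unit cochain on a path-connected set
  (`subsetCochains.exists_eq_smul_unitCochain`);
* **`finrank_deRhamCohomology_eq_bettiNumber_of_chartConvexCover`** — chaining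
  `nonempty_deRhamCohomology_equiv_cechCohomology` (Čech–de Rham, Bott–Tu Thm. 8.9),
  `thetaEquiv`, `cechSingularEquiv` (Čech–singular) and
  `finrank_smallCochainCohomology_eq_bettiNumber` (small cochains + universal coefficients):
  **`finrank_deRhamCohomology_eq_bettiNumber 𝓘(ℝ, E) M k`** for every compact Hausdorff `C^∞`
  manifold `M` modelled on `E` that admits a chart-convex finite cover.

## Part II — compact manifolds (`finrank_deRhamCohomology_eq_bettiNumber_of_compactSpace`)

We then construct a chart-convex finite cover on EVERY compact Hausdorff `C^∞` manifold `M`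
modelled on a finite-dimensional `E` (model `𝓘(ℝ, E)`), and conclude
**`finrank_deRhamCohomology_eq_bettiNumber 𝓘(ℝ, E) M k`** unconditionally: `dim_ℝ H^k_dR(M; ℝ) =
b_k(M; ℝ)` (de Rham 1931; A. Weil 1952; Bott–Tu (1982), Thm. 8.9 with Thm. 15.8 and Thm. 5.1).

The cover (a replacement for the geodesically convex balls of Bott–Tu (1982), Thm. 5.1, that needs
no Riemannian geometry): fix a Euclidean structure on `E` (`toEuclidean`), a finite atlas
`{chartAt E p}_{p ∈ t}`, a metric on `M` and a Lebesgue number `λ` of the atlas; every point `x`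
gets a chart `j x ∈ t` with `B_d(x, λ) ⊆ source (j x)`, and `U_x` is the preimage under the
chart `j x` of the EUCLIDEAN ball of one fixed radius `r` about the image of `x`. For `r` small
(uniformly, by compactness): (a) every `U_x` has `d`-diameter `< λ/3`, so all members of an
intersecting family lie in the chart of any one of them; (b) by
`Literature.Analysis.Convexity.exists_radius_convex_image_ball` (images of small balls under the
`C²` transition maps are convex) every member is CONVEX in that chart. Hence all nonempty finite
intersections of the finite subcover are chart sets of open convex sets.

* `exists_chartConvexCover` — the construction;
* `finrank_deRhamCohomology_eq_bettiNumber_of_compactSpace` — de Rham's theorem in the numerical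
  form of the named fact, for every compact Hausdorff `M` (boundaryless, model `𝓘(ℝ, E)`); the
  named fact's general `ModelWithCorners` form (boundary / corners) is not treated here.

No named facts; everything is proved.

## References

* R. Bott, L. W. Tu, *Differential Forms in Algebraic Topology*, GTM 82, Springer 1982,
  Thm. 5.1, Thm. 8.9, Thm. 15.8. [BottTu1982Forms]
* A. Weil, *Sur les théorèmes de de Rham*, Comment. Math. Helv. 26 (1952), 119–145.
* A. Hatcher, *Algebraic Topology*, CUP 2002, §3.1 p. 199 (`0`-cocycles), Thm. 3.2.
  [HatcherAT2002]
-/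

noncomputable section

-- as in `SingularChainsConcrete` / `LocalHomology` / `CechSingular`: chains of the concrete
-- complex are `Finsupp`s up to unfolding of semireducible definitions
set_option backward.isDefEq.respectTransparency false

open scoped Manifold ContDiff Topology
open Set CategoryTheory Literature.Algebra.Homology Literature.Geometry.Kaehler
open Literature.AlgebraicTopology.SingularHomology hiding cechSet mem_cechSet_iff cechSet_subset_comp
  cechSet_subset_apply cechSet_cons

universe u

namespace Literature.NumberTheory.Transcendental

variable {E : Type*} [NormedAddCommGroup E] [NormedSpace ℝ E]
  {M : Type u} [TopologicalSpace M] [ChartedSpace E M]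

/-! ### Chart sets for the trivial model `𝓘(ℝ, E)` -/

/-- For the model `𝓘(ℝ, E)` the extended chart is the chart (as a partial equivalence).
[folklore] -/
theorem extChartAt_self (p : M) : extChartAt 𝓘(ℝ, E) p = (chartAt E p).toPartialEquiv := by
  rw [extChartAt, OpenPartialHomeomorph.extend, modelWithCornersSelf_partialEquiv,
    PartialEquiv.trans_refl]

/-- For the model `𝓘(ℝ, E)` the chart set of `C` is `(chartAt E p).source ∩ (chartAt E p)⁻¹' C`.
[folklore] -/
theorem chartSet_self_eq (p : M) (C : Set E) :
    chartSet 𝓘(ℝ, E) p C = (chartAt E p).source ∩ chartAt E p ⁻¹' C := by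
  rw [chartSet, extChartAt_self]
  rfl

/-- The chart set of `C ⊆ target` is the image of `C` under the inverse chart. [folklore] -/
theorem chartSet_self_eq_symm_image (p : M) {C : Set E} (hCT : C ⊆ (chartAt E p).target) :
    chartSet 𝓘(ℝ, E) p C = (chartAt E p).symm '' C := by
  rw [chartSet_self_eq, (chartAt E p).symm_image_eq_source_inter_preimage hCT]

/-- **Chart sets of nonempty convex sets are contractible** (they are homeomorphic to the convex
set). [folklore] -/
theorem contractibleSpace_chartSet (p : M) {C : Set E} (hCc : Convex ℝ C) (hCne : C.Nonempty)
    (hCT : C ⊆ (chartAt E p).target) : ContractibleSpace ↥(chartSet 𝓘(ℝ, E) p C) := by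
  haveI : ContractibleSpace ↥C := hCc.contractibleSpace hCne
  rw [chartSet_self_eq_symm_image p hCT]
  exact ((chartAt E p).symm.homeomorphOfImageSubsetSource (s := C) (t := (chartAt E p).symm '' C)
    hCT rfl).symm.contractibleSpace

/-- **Chart sets of convex sets are path-connected or empty.** [folklore] -/
theorem isPathConnected_chartSet (p : M) {C : Set E} (hCc : Convex ℝ C) (hCne : C.Nonempty)
    (hCT : C ⊆ (chartAt E p).target) : IsPathConnected (chartSet 𝓘(ℝ, E) p C) := by
  rw [chartSet_self_eq_symm_image p hCT]
  exact (hCc.isPathConnected hCne).image' ((chartAt E p).continuousOn_symm.mono hCT)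

/-! ### Values of `0`-forms -/

/-- The value of a `0`-form at a point (the empty tuple of tangent vectors). [folklore] -/
def zval (α : MForm 𝓘(ℝ, E) M ℝ 0) (x : M) : ℝ :=
  α x default

/-- Two `0`-forms with the same values are equal. [folklore] -/
theorem eq_of_zval_eq {α β : MForm 𝓘(ℝ, E) M ℝ 0} (h : ∀ x, zval α x = zval β x) : α = β := by
  funext x
  ext v
  rw [Subsingleton.elim v default]
  exact h x

/-- The value of the constant `0`-form restricted to `W`, at a point of `W`. [folklore] -/
theorem zval_restr_const {W : Set M} (a : ℝ) {x : M} (hx : x ∈ W) :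
    zval ((MForm.const 𝓘(ℝ, E) M a).restr W) x = a := by
  rw [zval, MForm.restr_apply_of_mem _ hx]
  rfl

/-- The constant `0`-form restricted to an open set is a closed `0`-form on it. [folklore] -/
theorem restr_const_mem_localClosedForms [IsManifold 𝓘(ℝ, E) ∞ M] {W : Set M} (hW : IsOpen W) (a : ℝ) :
    (MForm.const 𝓘(ℝ, E) M a).restr W ∈ localClosedForms 𝓘(ℝ, E) ℝ 0 W :=
  restr_mem_localClosedForms hW (subset_univ W)
    (mem_localClosedForms_univ_of_mem_closedSmoothForms (const_mem_closedSmoothForms a))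

/-- Exact forms on equal open sets (transport along an equality of sets). [folklore] -/
theorem mem_localExactForms_congr [IsManifold 𝓘(ℝ, E) ∞ M] {F : Type*} [NormedAddCommGroup F]
    [NormedSpace ℝ F] {U V : Set M} (hU : IsOpen U) (hV : IsOpen V) (h : U = V) {k : ℕ}
    {α : MForm 𝓘(ℝ, E) M F k} (hα : α ∈ localExactForms 𝓘(ℝ, E) F hU k) :
    α ∈ localExactForms 𝓘(ℝ, E) F hV k := by
  subst h
  exact hα

/-! ### Chart-convex finite covers -/

variable (E M) in
/-- **A chart-convex cover** of a manifold `M` modelled on `E`: an open cover `(U_i)_{i ∈ ι}` of `M`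
each of whose NONEMPTY finite intersections `U_J = ⋂_k U_{J k}` is, in some chart `chartAt E p`, the
chart set of an open convex subset of the chart target. (A "good cover" in the sense of Bott–Tu
(1982), §5, made chart-wise; for compact `M` a finite one exists by shrinking chart balls.)
[cite: BottTu1982Forms, §5 Thm. 5.1] -/
structure ChartConvexCover (ι : Type*) where
  /-- the sets of the cover -/
  U : ι → Set M
  /-- they are open -/
  isOpen : ∀ i, IsOpen (U i)
  /-- they cover -/
  iUnion_eq : ⋃ i, U i = univ
  /-- every nonempty finite intersection is a chart set of an open convex set -/
  exists_chart : ∀ (n : ℕ) (J : Fin (n + 1) → ι), (cechSet U J).Nonempty →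
    ∃ (p : M) (C : Set E), IsOpen C ∧ Convex ℝ C ∧ C ⊆ (chartAt E p).target ∧
      cechSet U J = chartSet 𝓘(ℝ, E) p C

namespace ChartConvexCover

variable {ι : Type*} (𝒰 : ChartConvexCover E M ι)

/-- The cover property in the form `univ ⊆ ⋃ U_i`. [folklore] -/
theorem univ_subset : (univ : Set M) ⊆ ⋃ i, 𝒰.U i :=
  𝒰.iUnion_eq.symm.subset

variable [IsManifold 𝓘(ℝ, E) ∞ M]

/-- **Every finite intersection is de Rham-acyclic in positive degrees** (Poincaré lemma on
chart-convex sets, Lee (2013), Thm. 17.14; empty intersections carry no nonzero forms).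
[cite: LeeSmoothManifolds2013, Thm. 17.14] -/
theorem hgood [FiniteDimensional ℝ E] {F : Type*} [NormedAddCommGroup F] [NormedSpace ℝ F]
    [CompleteSpace F] (n q : ℕ) (J : Fin (n + 1) → ι) :
    localClosedForms 𝓘(ℝ, E) F (q + 1) (cechSet 𝒰.U J) ≤
      localExactForms 𝓘(ℝ, E) F (isOpen_cechSet 𝒰.isOpen J) (q + 1) := by
  rcases (cechSet 𝒰.U J).eq_empty_or_nonempty with he | hne
  · intro α hα
    have h0 : α = 0 := funext fun x ↦ hα.1.2 x (by rw [he]; exact notMem_empty x)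
    rw [h0]
    exact Submodule.zero_mem _
  · obtain ⟨p, C, hC, hCc, hCT, hJ⟩ := 𝒰.exists_chart n J hne
    have hCT' : C ⊆ (extChartAt 𝓘(ℝ, E) p).target := by rw [extChartAt_self]; exact hCT
    intro α hα
    have hα' : α ∈ localClosedForms 𝓘(ℝ, E) F (q + 1) (chartSet 𝓘(ℝ, E) p C) := hJ ▸ hα
    have h := localClosedForms_chartSet_le_localExactForms (I := 𝓘(ℝ, E)) (F := F) (k := q) p hC
      hCc hCT' hα'
    exact mem_localExactForms_congr _ _ hJ.symm h

/-- **Closed `0`-forms on a finite intersection are restrictions of constants** (on a chart set of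
a convex set a closed `0`-form takes one value in the chart, Lee (2013), Prop. 17.6).
[cite: LeeSmoothManifolds2013, Prop. 17.6] -/
theorem exists_const (n : ℕ) (J : Fin (n + 1) → ι) {α : MForm 𝓘(ℝ, E) M ℝ 0}
    (hα : α ∈ localClosedForms 𝓘(ℝ, E) ℝ 0 (cechSet 𝒰.U J)) :
    ∃ a : ℝ, α = (MForm.const 𝓘(ℝ, E) M a).restr (cechSet 𝒰.U J) := by
  rcases (cechSet 𝒰.U J).eq_empty_or_nonempty with he | ⟨x₀, hx₀⟩
  · refine ⟨0, funext fun x ↦ ?_⟩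
    rw [hα.1.2 x (by rw [he]; exact notMem_empty x), MForm.restr_apply_of_notMem _
      (by rw [he]; exact notMem_empty x)]
  · obtain ⟨p, C, hC, hCc, hCT, hJ⟩ := 𝒰.exists_chart n J ⟨x₀, hx₀⟩
    have hCT' : C ⊆ (extChartAt 𝓘(ℝ, E) p).target := by rw [extChartAt_self]; exact hCT
    refine ⟨zval α x₀, ?_⟩
    set β := (MForm.const 𝓘(ℝ, E) M (zval α x₀)).restr (cechSet 𝒰.U J) with hβ
    have hβc : β ∈ localClosedForms 𝓘(ℝ, E) ℝ 0 (cechSet 𝒰.U J) :=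
      restr_const_mem_localClosedForms (isOpen_cechSet 𝒰.isOpen J) _
    have hx₀' : x₀ ∈ chartSet 𝓘(ℝ, E) p C := hJ ▸ hx₀
    -- the two forms agree at `x₀`, hence have the same representative at `c₀ = e x₀ ∈ C`
    have heq : α x₀ = β x₀ := by
      ext v
      rw [Subsingleton.elim v default, hβ, MForm.restr_apply_of_mem _ hx₀]
      rfl
    have hsymm : (extChartAt 𝓘(ℝ, E) p).symm (extChartAt 𝓘(ℝ, E) p x₀) = x₀ :=
      (extChartAt 𝓘(ℝ, E) p).left_inv hx₀'.1
    have hrep : α.inChart p (extChartAt 𝓘(ℝ, E) p x₀) = β.inChart p (extChartAt 𝓘(ℝ, E) p x₀) := by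
      have heq' : α ((extChartAt 𝓘(ℝ, E) p).symm (extChartAt 𝓘(ℝ, E) p x₀)) =
          β ((extChartAt 𝓘(ℝ, E) p).symm (extChartAt 𝓘(ℝ, E) p x₀)) := by
        rw [hsymm]
        exact heq
      simp only [MForm.inChart]
      rw [heq']
    rw [hJ] at hα hβc
    exact eq_of_inChart_apply_eq_of_mem_localClosedForms_zero (I := 𝓘(ℝ, E)) p hC hCc hCT' hα hβc
      hx₀'.2 hrep

omit [IsManifold 𝓘(ℝ, E) ∞ M] in
/-- **Every finite intersection is acyclic for singular cochains** with coefficients `ULift ℝ`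
(contractible or empty). [folklore] -/
theorem hacyc (n q : ℕ) (J : Fin (n + 1) → ι)
    (ψ : CochainOn ℝ (ULift.{u} ℝ) (cechSet 𝒰.U J) (q + 1))
    (hψ : cod (cechSet 𝒰.U J) (q + 1) ψ = 0) :
    ∃ φ : CochainOn ℝ (ULift.{u} ℝ) (cechSet 𝒰.U J) q, cod (cechSet 𝒰.U J) q φ = ψ := by
  rcases (cechSet 𝒰.U J).eq_empty_or_nonempty with he | hne
  · exact exists_cod_eq_of_eq_empty he ψ
  · obtain ⟨p, C, hC, hCc, hCT, hJ⟩ := 𝒰.exists_chart n J hne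
    have hCne : C.Nonempty := by
      obtain ⟨x, hx⟩ := hne
      rw [hJ] at hx
      exact ⟨_, hx.2⟩
    haveI : ContractibleSpace ↥(cechSet 𝒰.U J) := by
      rw [hJ]
      exact contractibleSpace_chartSet p hCc hCne hCT
    exact exists_cod_eq_of_contractibleSpace (cechSet 𝒰.U J) ψ hψ

omit [IsManifold 𝓘(ℝ, E) ∞ M] in
/-- Every finite intersection is path-connected or empty. [folklore] -/
theorem isPathConnected_or_empty (n : ℕ) (J : Fin (n + 1) → ι) :
    cechSet 𝒰.U J = ∅ ∨ IsPathConnected (cechSet 𝒰.U J) := by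
  rcases (cechSet 𝒰.U J).eq_empty_or_nonempty with he | hne
  · exact Or.inl he
  · obtain ⟨p, C, hC, hCc, hCT, hJ⟩ := 𝒰.exists_chart n J hne
    have hCne : C.Nonempty := by
      obtain ⟨x, hx⟩ := hne
      rw [hJ] at hx
      exact ⟨_, hx.2⟩
    rw [hJ]
    exact Or.inr (isPathConnected_chartSet p hCc hCne hCT)

end ChartConvexCover

/-! ### Closed `0`-forms to `0`-cochains -/

section Theta

/-- The `0`-cochain of `W` attached to a `0`-form: `σ ↦ α(σ.pt)` on the simplices, extended
linearly (the de Rham–singular comparison in degree `0`; Bott–Tu (1982), proof of Thm. 8.9 /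
Thm. 15.8, the constant presheaf `ℝ` seen on both sides). [cite: BottTu1982Forms, Thm. 15.8] -/
def formCochain (W : Set M) (α : MForm 𝓘(ℝ, E) M ℝ 0) : CochainOn ℝ (ULift.{u} ℝ) W 0 where
  toFun x := Finsupp.linearCombination ℝ
    (fun σ : SingularSimplex M 0 ↦ ULift.up (zval α σ.pt)) x.1
  map_add' x y := map_add _ x.1 y.1
  map_smul' r x := map_smul _ r x.1

/-- The value of `formCochain W α` on a `0`-simplex of `W`. [folklore] -/
theorem evalSimplex_formCochain (W : Set M) (α : MForm 𝓘(ℝ, E) M ℝ 0) {σ : SingularSimplex M 0}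
    (hσ : σ.range ⊆ W) : evalSimplex (formCochain W α) σ = ULift.up (zval α σ.pt) := by
  rw [evalSimplex_of_subset _ hσ]
  change Finsupp.linearCombination ℝ _ (Finsupp.single σ (1 : ℝ)) = _
  rw [Finsupp.linearCombination_single, one_smul]

/-- `formCochain W` is additive. [folklore] -/
theorem formCochain_add (W : Set M) (α β : MForm 𝓘(ℝ, E) M ℝ 0) :
    formCochain W (α + β) = formCochain W α + formCochain W β := by
  refine ext_evalSimplex fun σ hσ ↦ ?_
  rw [evalSimplex_add, evalSimplex_formCochain W _ hσ, evalSimplex_formCochain W _ hσ,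
    evalSimplex_formCochain W _ hσ]
  rfl

/-- `formCochain W` is homogeneous. [folklore] -/
theorem formCochain_smul (W : Set M) (r : ℝ) (α : MForm 𝓘(ℝ, E) M ℝ 0) :
    formCochain W (r • α) = r • formCochain W α := by
  refine ext_evalSimplex fun σ hσ ↦ ?_
  rw [evalSimplex_smul, evalSimplex_formCochain W _ hσ, evalSimplex_formCochain W _ hσ]
  rfl

/-- `formCochain W` as a linear map in the form. [folklore] -/
def formCochainₗ (W : Set M) : MForm 𝓘(ℝ, E) M ℝ 0 →ₗ[ℝ] CochainOn ℝ (ULift.{u} ℝ) W 0 where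
  toFun := formCochain W
  map_add' := formCochain_add W
  map_smul' := formCochain_smul W

/-- `formCochain W` of a finite sum. [folklore] -/
theorem formCochain_sum (W : Set M) {β : Type*} (s : Finset β) (f : β → MForm 𝓘(ℝ, E) M ℝ 0) :
    formCochain W (∑ b ∈ s, f b) = ∑ b ∈ s, formCochain W (f b) :=
  map_sum (formCochainₗ W) f s

/-- **Naturality**: restriction of cochains corresponds to restriction (by the indicator) of
`0`-forms. [folklore] -/
theorem cres_formCochain {V W : Set M} (h : W ⊆ V) (α : MForm 𝓘(ℝ, E) M ℝ 0) :
    cres h 0 (formCochain V α) = formCochain W (α.restr W) := by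
  refine ext_evalSimplex fun σ hσ ↦ ?_
  rw [evalSimplex_cres h _ hσ, evalSimplex_formCochain V _ (hσ.trans h), evalSimplex_formCochain W _ hσ,
    zval, zval, MForm.restr_apply_of_mem _ (hσ (SingularSimplex.pt_mem_range σ))]

/-- `formCochain W` only sees the values on `W`. [folklore] -/
theorem formCochain_restr (W : Set M) (α : MForm 𝓘(ℝ, E) M ℝ 0) :
    formCochain W (α.restr W) = formCochain W α := by
  refine ext_evalSimplex fun σ hσ ↦ ?_
  rw [evalSimplex_formCochain W _ hσ, evalSimplex_formCochain W _ hσ, zval, zval,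
    MForm.restr_apply_of_mem _ (hσ (SingularSimplex.pt_mem_range σ))]

/-- The elementary `1`-chain of `τ ⊆ W` has boundary `τ.face 0 - τ.face 1`. [folklore] -/
theorem d_elemChain_one {W : Set M} {τ : SingularSimplex M 1} (hτ : τ.range ⊆ W) :
    ((chainsInSub ℝ ℝ M W).toComplex.d 1 0).hom (elemChain hτ) =
      elemChain (q := 0) ((SingularSimplex.range_face_subset 0 τ).trans hτ) -
        elemChain (q := 0) ((SingularSimplex.range_face_subset 1 τ).trans hτ) := by
  apply Subtype.ext
  change ((chainsInSub ℝ ℝ M W).toComplex.d 1 0 (elemChain hτ)).1 = _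
  rw [toComplex_d_val]
  change csingularChainComplex.bd ℝ 0 (Finsupp.single τ (1 : ℝ)) = _
  rw [csingularChainComplex.bd_single, Fin.sum_univ_two, Fin.val_zero, pow_zero, one_smul,
    Fin.val_one, pow_one, neg_one_smul, ← sub_eq_add_neg]
  rfl

/-- **The cochain of a restricted constant is a cocycle**: `δ(a) (τ) = a - a = 0`. [folklore] -/
theorem cod_formCochain_restr_const {W : Set M} (a : ℝ) :
    cod W 0 (formCochain W ((MForm.const 𝓘(ℝ, E) M a).restr W)) = 0 := by
  refine ext_evalSimplex fun τ hτ ↦ ?_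
  rw [evalSimplex_of_subset _ hτ, evalSimplex_of_subset _ hτ, LinearMap.zero_apply, cod_apply,
    d_elemChain_one hτ, map_sub, ← evalSimplex_of_subset _ ((SingularSimplex.range_face_subset 0 τ).trans hτ),
    ← evalSimplex_of_subset _ ((SingularSimplex.range_face_subset 1 τ).trans hτ),
    evalSimplex_formCochain W _ ((SingularSimplex.range_face_subset 0 τ).trans hτ),
    evalSimplex_formCochain W _ ((SingularSimplex.range_face_subset 1 τ).trans hτ),
    zval_restr_const a (((SingularSimplex.range_face_subset 0 τ).trans hτ) (SingularSimplex.pt_mem_range _)),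
    zval_restr_const a (((SingularSimplex.range_face_subset 1 τ).trans hτ) (SingularSimplex.pt_mem_range _)),
    sub_self]

/-- **`formCochain W` is injective on the `0`-forms vanishing off `W`** (evaluate on the
`0`-simplex at each point of `W`). [folklore] -/
theorem eq_of_formCochain_eq {W : Set M} {α β : MForm 𝓘(ℝ, E) M ℝ 0}
    (hα : ∀ x ∉ W, α x = 0) (hβ : ∀ x ∉ W, β x = 0) (h : formCochain W α = formCochain W β) :
    α = β := by
  refine eq_of_zval_eq fun x ↦ ?_
  by_cases hx : x ∈ W
  · have hσ : (SingularSimplex.ofPoint x).range ⊆ W := by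
      rw [SingularSimplex.range_ofPoint, singleton_subset_iff]
      exact hx
    have h' := congrArg (fun ψ ↦ evalSimplex ψ (SingularSimplex.ofPoint x)) h
    simp only [evalSimplex_formCochain W _ hσ, SingularSimplex.pt_ofPoint] at h'
    exact ULift.up_injective h'
  · rw [zval, zval, hα x hx, hβ x hx]

/-- The unit cochain takes the value `1` on the elementary chains of `W`. [folklore] -/
theorem unitCochain_elemChain {W : Set M} {σ : SingularSimplex M 0} (hσ : σ.range ⊆ W) :
    (unitCochain ℝ W).hom (elemChain hσ) = ULift.up 1 := by
  change (ULift.moduleEquiv (R := ℝ) (M := ℝ)).symm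
    (Finsupp.linearCombination ℝ (fun _ : SingularSimplex M 0 ↦ (1 : ℝ)) (Finsupp.single σ 1)) = _
  rw [Finsupp.linearCombination_single, one_smul]
  rfl

/-- **On a path-connected set every `0`-cocycle is the cochain of a restricted constant** (a
`0`-cocycle is a multiple of the unit cochain, Hatcher 2002, §3.1 p. 199 /
`subsetCochains.exists_eq_smul_unitCochain`). [cite: HatcherAT2002, §3.1 p. 199] -/
theorem exists_formCochain_eq_of_isPathConnected {W : Set M} (hW : IsPathConnected W)
    (ψ : CochainOn ℝ (ULift.{u} ℝ) W 0) (hψ : cod W 0 ψ = 0) :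
    ∃ a : ℝ, formCochain W ((MForm.const 𝓘(ℝ, E) M a).restr W) = ψ := by
  have hψ' : (subsetCochains ℝ (SimplexSpan.coefR ℝ) W).d 0 1 (ModuleCat.ofHom ψ) = 0 := by
    rw [dualObj_d_apply]
    apply ModuleCat.hom_ext
    rw [ModuleCat.hom_comp, ModuleCat.hom_ofHom, ModuleCat.hom_zero]
    exact hψ
  obtain ⟨r, hr⟩ := subsetCochains.exists_eq_smul_unitCochain hW (ModuleCat.ofHom ψ) hψ'
  refine ⟨r, ext_evalSimplex fun σ hσ ↦ ?_⟩
  rw [evalSimplex_formCochain W _ hσ, zval_restr_const r (hσ (SingularSimplex.pt_mem_range σ)),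
    evalSimplex_of_subset _ hσ]
  have h := congrArg (fun φ ↦ ModuleCat.Hom.hom (R := ℝ) φ (elemChain hσ)) hr
  dsimp only at h
  rw [ModuleCat.hom_ofHom, ModuleCat.hom_smul, LinearMap.smul_apply] at h
  rw [h, unitCochain_elemChain hσ]
  apply ULift.ext
  change r = r • (1 : ℝ)
  rw [smul_eq_mul, mul_one]

/-- On the empty set every cochain of positive... indeed every `0`-cochain vanishes. [folklore] -/
theorem cochainOn_zero_eq_zero_of_eq_empty {W : Set M} (hW : W = ∅) (ψ : CochainOn ℝ (ULift.{u} ℝ) W 0) :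
    ψ = 0 := by
  refine ext_evalSimplex fun σ hσ ↦ ?_
  exfalso
  have h := hσ (SingularSimplex.pt_mem_range σ)
  rw [hW] at h
  exact h

variable {ι : Type*} {U : ι → Set M} (hU : ∀ i, IsOpen (U i))
  (hconst : ∀ (n : ℕ) (J : Fin (n + 1) → ι) (α : MForm 𝓘(ℝ, E) M ℝ 0),
    α ∈ localClosedForms 𝓘(ℝ, E) ℝ 0 (cechSet U J) →
      ∃ a : ℝ, α = (MForm.const 𝓘(ℝ, E) M a).restr (cechSet U J))
  (hpath : ∀ (n : ℕ) (J : Fin (n + 1) → ι), cechSet U J = ∅ ∨ IsPathConnected (cechSet U J))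

include hconst in
/-- The cochain of a closed `0`-form on a finite intersection is a `0`-cocycle. [folklore] -/
theorem formCochain_mem_zeroCocycles {n : ℕ} (J : Fin (n + 1) → ι)
    (α : ↥(localClosedForms 𝓘(ℝ, E) ℝ 0 (cechSet U J))) :
    formCochain (cechSet U J) (α : MForm 𝓘(ℝ, E) M ℝ 0) ∈
      zeroCocycles ℝ (ULift.{u} ℝ) (Literature.AlgebraicTopology.SingularHomology.cechSet U J) := by
  obtain ⟨a, ha⟩ := hconst n J α α.2
  rw [LinearMap.mem_ker, ha]
  exact cod_formCochain_restr_const a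

/-- **The comparison of the two Čech complexes of degree-`0` coefficients**: closed `0`-forms
on the finite intersections to singular `0`-cocycles, `(α_J) ↦ (σ ↦ α_J(σ.pt))`.
[cite: BottTu1982Forms, Thm. 15.8] -/
def theta (n : ℕ) :
    CechClosedZeroForms 𝓘(ℝ, E) ℝ U n →ₗ[ℝ] CechZeroCocycles ℝ (ULift.{u} ℝ) U n where
  toFun b J := ⟨formCochain (cechSet U J) (b J : MForm 𝓘(ℝ, E) M ℝ 0),
    formCochain_mem_zeroCocycles hconst J (b J)⟩
  map_add' b b' := by
    funext J
    apply Subtype.ext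
    change formCochain (cechSet U J) ((b J : MForm 𝓘(ℝ, E) M ℝ 0) + (b' J : MForm 𝓘(ℝ, E) M ℝ 0)) =
      formCochain (cechSet U J) (b J : MForm 𝓘(ℝ, E) M ℝ 0) +
        formCochain (cechSet U J) (b' J : MForm 𝓘(ℝ, E) M ℝ 0)
    exact formCochain_add _ _ _
  map_smul' r b := by
    funext J
    apply Subtype.ext
    change formCochain (cechSet U J) (r • (b J : MForm 𝓘(ℝ, E) M ℝ 0)) =
      r • formCochain (cechSet U J) (b J : MForm 𝓘(ℝ, E) M ℝ 0)
    exact formCochain_smul _ _ _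

/-- `theta` on a component. [folklore] -/
theorem coe_theta_apply (n : ℕ) (b : CechClosedZeroForms 𝓘(ℝ, E) ℝ U n) (J : Fin (n + 1) → ι) :
    (theta hconst n b J).1 = formCochain (cechSet U J) (b J : MForm 𝓘(ℝ, E) M ℝ 0) :=
  rfl

/-- The Čech differential on closed `0`-forms, componentwise on the level of the subtype. [folklore] -/
theorem cechClosedδ_apply (n : ℕ) (b : CechClosedZeroForms 𝓘(ℝ, E) ℝ U n) (J : Fin (n + 2) → ι) :
    cechClosedδ 𝓘(ℝ, E) ℝ hU n b J = ∑ j : Fin (n + 2), (-1 : ℝ) ^ (j : ℕ) •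
      restrictClosedₗ 𝓘(ℝ, E) ℝ 0 (isOpen_cechSet hU J) (cechSet_subset_comp U J (Fin.succAbove j))
        (b (J ∘ Fin.succAbove j)) :=
  rfl

/-- **`theta` is a cochain map** between the two Čech complexes. [folklore] -/
theorem theta_comm (n : ℕ) (b : CechClosedZeroForms 𝓘(ℝ, E) ℝ U n) :
    theta hconst (n + 1) (cechClosedδ 𝓘(ℝ, E) ℝ hU n b) =
      cechZeroδ ℝ (ULift.{u} ℝ) U n (theta hconst n b) := by
  funext J
  apply Subtype.ext
  rw [coe_theta_apply, coe_cechZeroδ_apply, cechClosedδ_apply hU, Submodule.coe_sum, formCochain_sum]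
  refine Finset.sum_congr rfl fun j _ ↦ ?_
  rw [Submodule.coe_smul, formCochain_smul, coe_restrictClosedₗ, coe_theta_apply]
  congr 1
  exact (cres_formCochain _ _).symm

include hU hpath in
/-- **`theta` is bijective** (injective always; surjective because a `0`-cocycle of a
path-connected set is a multiple of the unit cochain). [cite: HatcherAT2002, §3.1 p. 199] -/
theorem bijective_theta [IsManifold 𝓘(ℝ, E) ∞ M] (n : ℕ) :
    Function.Bijective (theta (U := U) hconst n) := by
  constructor
  · intro b b' h
    funext J
    apply Subtype.ext
    have hJ := congrArg (fun c : CechZeroCocycles ℝ (ULift.{u} ℝ) U n ↦ (c J).1) h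
    simp only [coe_theta_apply] at hJ
    exact eq_of_formCochain_eq (b J).2.1.2 (b' J).2.1.2 hJ
  · intro c
    have key : ∀ J : Fin (n + 1) → ι, ∃ a : ℝ,
        formCochain (cechSet U J) ((MForm.const 𝓘(ℝ, E) M a).restr (cechSet U J)) = (c J).1 :=
      fun J ↦ by
      rcases hpath n J with he | hp
      · exact ⟨0, (cochainOn_zero_eq_zero_of_eq_empty he _).trans
          (cochainOn_zero_eq_zero_of_eq_empty he (c J).1).symm⟩
      · exact exists_formCochain_eq_of_isPathConnected hp (c J).1 (LinearMap.mem_ker.1 (c J).2)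
    choose a ha using key
    refine ⟨fun J ↦ ⟨(MForm.const 𝓘(ℝ, E) M (a J)).restr (cechSet U J),
      restr_const_mem_localClosedForms (isOpen_cechSet hU J) (a J)⟩, ?_⟩
    funext J
    apply Subtype.ext
    rw [coe_theta_apply]
    exact ha J

/-- **The two Čech complexes of degree-`0` coefficients have isomorphic cohomology** (for a cover
whose finite intersections are path-connected or empty and carry only constant closed
`0`-forms): `Hⁿ(C^•(𝔘, Z⁰_dR)) ≃ₗ[ℝ] Hⁿ(C^•(𝔘, Z⁰_sing(ULift ℝ)))`. [cite: BottTu1982Forms, Thm. 15.8] -/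
def thetaEquiv [IsManifold 𝓘(ℝ, E) ∞ M] (n : ℕ) :
    NatCochain.Cohomology (cechClosedδ 𝓘(ℝ, E) ℝ hU) n ≃ₗ[ℝ]
      NatCochain.Cohomology (cechZeroδ ℝ (ULift.{u} ℝ) U) n :=
  NatCochain.Cohomology.equivOfBijective (theta hconst) (theta_comm hU hconst)
    (bijective_theta hU hconst hpath) n

end Theta

/-! ### de Rham's theorem for a manifold with a chart-convex finite cover -/

/-- **de Rham's theorem, numerical form, from a chart-convex finite cover**: for a compact
Hausdorff `C^∞` manifold `M` modelled on the finite-dimensional space `E` (model `𝓘(ℝ, E)`)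
that admits a finite chart-convex cover, `dim_ℝ H^k_dR(M; ℝ) = b_k(M; ℝ)` for every `k`, i.e. the
named fact `finrank_deRhamCohomology_eq_bettiNumber 𝓘(ℝ, E) M k` holds. Chain:
`H_dR(M) ≅ H(C(𝔘, Z⁰_dR))` (Čech–de Rham, Bott–Tu Thm. 8.9) `≅ H(C(𝔘, Z⁰_sing))` (`thetaEquiv`)
`≅ H(Hom(C^𝔘, ULift ℝ))` (Čech–singular) and `dim = b_k` (small cochains, universal
coefficients). A. Weil (1952); Bott–Tu (1982), Thm. 8.9 and Thm. 15.8. [cite: BottTu1982Forms, Thm. 15.8] -/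
theorem finrank_deRhamCohomology_eq_bettiNumber_of_chartConvexCover [FiniteDimensional ℝ E]
    [IsManifold 𝓘(ℝ, E) ∞ M] [T2Space M] [CompactSpace M] {ι : Type*} [Fintype ι]
    (𝒰 : ChartConvexCover E M ι) (k : ℕ) :
    finrank_deRhamCohomology_eq_bettiNumber 𝓘(ℝ, E) M k := by
  unfold finrank_deRhamCohomology_eq_bettiNumber
  -- de Rham side
  obtain ⟨e₁⟩ := nonempty_deRhamCohomology_equiv_cechCohomology (I := 𝓘(ℝ, E)) (F := ℝ) 𝒰.isOpen
    𝒰.iUnion_eq (fun n q J ↦ 𝒰.hgood n q J) k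
  -- degree-`0` coefficients
  have e₂ := thetaEquiv 𝒰.isOpen (fun n J α hα ↦ 𝒰.exists_const n J hα)
    (fun n J ↦ 𝒰.isPathConnected_or_empty n J) k
  -- singular side
  have e₃ := cechSingularEquiv (R := ℝ) (N := ULift.{u} ℝ) 𝒰.U (fun n q J ψ hψ ↦ 𝒰.hacyc n q J ψ hψ) k
  rw [e₁.finrank_eq, e₂.finrank_eq, ← e₃.finrank_eq]
  exact finrank_smallCochainCohomology_eq_bettiNumber 𝒰.U 𝒰.isOpen 𝒰.univ_subset k

end Literature.NumberTheory.Transcendental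

/-! ## Part II — chart-convex finite covers on compact manifolds, de Rham's theorem -/

open scoped Manifold ContDiff Topology
open Set Metric Literature.Geometry.Kaehler Literature.Analysis.Convexity

namespace Literature.NumberTheory.Transcendental

variable {E : Type*} [NormedAddCommGroup E] [NormedSpace ℝ E] [FiniteDimensional ℝ E]
  {M : Type u} [TopologicalSpace M] [ChartedSpace E M]

/-! ### Charts read in the Euclidean structure, transition maps -/

/-- The Euclidean model of `E`. -/
local notation "V" => EuclideanSpace ℝ (Fin (Module.finrank ℝ E))

/-- The Euclidean identification `E ≃L[ℝ] V`. -/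
local notation "ιE" => (toEuclidean (E := E))

variable (E) in
/-- The chart at `p` read in the Euclidean structure: `ψ_p = ιE ∘ chartAt E p`. [folklore] -/
def echart (p : M) : M → V := fun x ↦ ιE (chartAt E p x)

variable (E) in
/-- Its inverse `ψ_p⁻¹ = (chartAt E p)⁻¹ ∘ ιE⁻¹` (meaningful on `ιE '' target`). [folklore] -/
def echartInv (p : M) : V → M := fun v ↦ (chartAt E p).symm ((ιE).symm v)

variable (E) in
/-- The transition map `τ_{pq} = ψ_q ∘ ψ_p⁻¹ : V → V` between the Euclidean charts. [folklore] -/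
def etrans (p q : M) : V → V := fun v ↦ echart E q (echartInv E p v)

variable (E) in
/-- The domain of the transition map `τ_{pq}`: `ιE (target_p ∩ (chartAt E p)⁻¹ (source_q))`.
[folklore] -/
def edom (p q : M) : Set V :=
  (ιE).symm ⁻¹' ((chartAt E p).target ∩ (chartAt E p).symm ⁻¹' (chartAt E q).source)

/-- `ψ_p⁻¹ (ψ_p x) = x` on the source. [folklore] -/
theorem echartInv_echart {p x : M} (hx : x ∈ (chartAt E p).source) : echartInv E p (echart E p x) = x := by
  show (chartAt E p).symm ((ιE).symm (ιE (chartAt E p x))) = x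
  rw [ContinuousLinearEquiv.symm_apply_apply, (chartAt E p).left_inv hx]

/-- `ψ_p (ψ_p⁻¹ v) = v` when `ιE⁻¹ v ∈ target`. [folklore] -/
theorem echart_echartInv {p : M} {v : V} (hv : (ιE).symm v ∈ (chartAt E p).target) :
    echart E p (echartInv E p v) = v := by
  show ιE (chartAt E p ((chartAt E p).symm ((ιE).symm v))) = v
  rw [(chartAt E p).right_inv hv, ContinuousLinearEquiv.apply_symm_apply]

/-- The domain of a transition map is open. [folklore] -/
theorem isOpen_edom (p q : M) : IsOpen (edom E p q) :=
  ((chartAt E p).continuousOn_symm.isOpen_inter_preimage (chartAt E p).open_target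
    (chartAt E q).open_source).preimage (ιE).symm.continuous

/-- Membership in the domain. [folklore] -/
theorem mem_edom_iff {p q : M} {v : V} :
    v ∈ edom E p q ↔ (ιE).symm v ∈ (chartAt E p).target ∧ echartInv E p v ∈ (chartAt E q).source :=
  Iff.rfl

/-- `τ_{pq}` maps its domain to the domain of `τ_{qp}`. [folklore] -/
theorem mapsTo_etrans (p q : M) : MapsTo (etrans E p q) (edom E p q) (edom E q p) := by
  intro v hv
  rw [mem_edom_iff] at hv ⊢
  have hx : echartInv E p v ∈ (chartAt E p).source := (chartAt E p).map_target hv.1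
  refine ⟨?_, ?_⟩
  · show (ιE).symm (ιE (chartAt E q (echartInv E p v))) ∈ (chartAt E q).target
    rw [ContinuousLinearEquiv.symm_apply_apply]
    exact (chartAt E q).map_source hv.2
  · show echartInv E q (echart E q (echartInv E p v)) ∈ (chartAt E p).source
    rw [echartInv_echart hv.2]
    exact hx

/-- `τ_{qp} ∘ τ_{pq} = id` on the domain. [folklore] -/
theorem etrans_etrans {p q : M} {v : V} (hv : v ∈ edom E p q) : etrans E q p (etrans E p q v) = v := by
  rw [mem_edom_iff] at hv
  show echart E p (echartInv E q (echart E q (echartInv E p v))) = v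
  rw [echartInv_echart hv.2, echart_echartInv hv.1]

/-- **The transition maps are `C^∞`** (the charts of a `C^∞` manifold are `C^∞`-compatible;
Mathlib's `contDiffOn_ext_coord_change`, conjugated by the linear `ιE`). [folklore] -/
theorem contDiffOn_etrans [IsManifold 𝓘(ℝ, E) ∞ M] (p q : M) :
    ContDiffOn ℝ ∞ (etrans E p q) (edom E p q) := by
  have h := contDiffOn_ext_coord_change (I := 𝓘(ℝ, E)) (n := ∞) q p
  rw [extChartAt_self, extChartAt_self] at h
  -- `etrans = ιE ∘ (e_q ∘ e_p.symm) ∘ ιE.symm`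
  have h1 : ContDiffOn ℝ ∞ ((chartAt E q).toPartialEquiv ∘ (chartAt E p).toPartialEquiv.symm)
      ((ιE).symm '' edom E p q) := by
    refine h.mono ?_
    rintro _ ⟨v, hv, rfl⟩
    rw [mem_edom_iff] at hv
    exact ⟨hv.1, hv.2⟩
  have h2 : ContDiffOn ℝ ∞ (fun v : V ↦ ((chartAt E q).toPartialEquiv ∘ (chartAt E p).toPartialEquiv.symm)
      ((ιE).symm v)) (edom E p q) :=
    h1.comp (ιE).symm.contDiff.contDiffOn (mapsTo_image _ _)
  have h3 := (ιE).contDiff.comp_contDiffOn h2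
  exact h3

/-! ### The balls of the cover -/

variable (E) in
/-- The Euclidean chart ball `B(z; p, r) = source_p ∩ ψ_p⁻¹ (ball (ψ_p z) r)`. [folklore] -/
def eball (p z : M) (r : ℝ) : Set M :=
  (chartAt E p).source ∩ echart E p ⁻¹' ball (echart E p z) r

/-- Euclidean chart balls are open. [folklore] -/
theorem isOpen_eball (p z : M) (r : ℝ) : IsOpen (eball E p z r) := by
  refine ContinuousOn.isOpen_inter_preimage ?_ (chartAt E p).open_source isOpen_ball
  exact (ιE).continuous.comp_continuousOn (chartAt E p).continuousOn

/-- The centre lies in its ball. [folklore] -/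
theorem mem_eball {p z : M} (hz : z ∈ (chartAt E p).source) {r : ℝ} (hr : 0 < r) : z ∈ eball E p z r :=
  ⟨hz, mem_ball_self hr⟩

/-- A Euclidean chart ball is the image of the Euclidean ball under `ψ_p⁻¹`, provided the ball
lies in `ιE '' target_p`. [folklore] -/
theorem eball_eq_image {p z : M} {r : ℝ} (hB : ∀ v ∈ ball (echart E p z) r, (ιE).symm v ∈ (chartAt E p).target) :
    eball E p z r = echartInv E p '' ball (echart E p z) r := by
  ext x
  constructor
  · rintro ⟨hx, hxb⟩
    exact ⟨echart E p x, hxb, echartInv_echart hx⟩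
  · rintro ⟨v, hv, rfl⟩
    refine ⟨(chartAt E p).map_target (hB v hv), ?_⟩
    show echart E p (echartInv E p v) ∈ ball (echart E p z) r
    rw [echart_echartInv (hB v hv)]
    exact hv

/-- **A chart ball of chart `q` read in chart `p`**: if the Euclidean ball lies in the domain of
`τ_{qp}`, then `B(y; q, r) ⊆ source_p` and `ψ_p (B(y; q, r)) = τ_{qp} (ball (ψ_q y) r)`.
[folklore] -/
theorem eball_subset_source_and_image {p q y : M} {r : ℝ}
    (hB : ball (echart E q y) r ⊆ edom E q p) :
    eball E q y r ⊆ (chartAt E p).source ∧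
      echart E p '' eball E q y r = etrans E q p '' ball (echart E q y) r := by
  have hB' : ∀ v ∈ ball (echart E q y) r, (ιE).symm v ∈ (chartAt E q).target := fun v hv ↦ (hB hv).1
  rw [eball_eq_image hB', image_image]
  refine ⟨?_, rfl⟩
  rintro _ ⟨v, hv, rfl⟩
  exact (hB hv).2

omit [NormedSpace ℝ E] [FiniteDimensional ℝ E] in
/-- A subset `A ⊆ source_p` is recovered from its chart image: `A = source_p ∩ e_p⁻¹ (e_p '' A)`.
[folklore] -/
theorem eq_source_inter_preimage_image {p : M} {A : Set M} (hA : A ⊆ (chartAt E p).source) :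
    A = (chartAt E p).source ∩ chartAt E p ⁻¹' (chartAt E p '' A) := by
  rw [inter_comm, (chartAt E p).injOn.preimage_image_inter hA]

/-- Linear images under `ιE⁻¹` of convex sets are convex. [folklore] -/
theorem convex_image_symm {A : Set V} (hA : Convex ℝ A) : Convex ℝ ((ιE).symm '' A) :=
  hA.linear_image (ιE).symm.toLinearEquiv.toLinearMap

/-- `chartAt E p '' A = ιE⁻¹ '' (ψ_p '' A)`. [folklore] -/
theorem image_chartAt_eq (p : M) (A : Set M) :
    chartAt E p '' A = (ιE).symm '' (echart E p '' A) := by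
  rw [image_image]
  refine image_congr fun x _ ↦ ?_
  simp [echart]

/-! ### The chart-convex finite cover of a compact manifold -/

/-- **Compact boundaryless manifolds have chart-convex finite covers** (a good cover by chart
balls: Bott–Tu (1982), Thm. 5.1, with small EUCLIDEAN chart balls — convex in every nearby chart
by `exists_radius_convex_image_ball` — in place of geodesically convex balls).
[cite: BottTu1982Forms, Thm. 5.1] -/
theorem exists_chartConvexCover [IsManifold 𝓘(ℝ, E) ∞ M] [T2Space M] [CompactSpace M] :
    ∃ s : Finset M, Nonempty (ChartConvexCover E M ↥s) := by
  classical
  rcases isEmpty_or_nonempty M with hM | hM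
  · refine ⟨∅, ⟨?_⟩⟩
    exact
      { U := fun _ ↦ ∅
        isOpen := fun _ ↦ isOpen_empty
        iUnion_eq := eq_univ_of_forall fun x ↦ isEmptyElim x
        exists_chart := fun n J _ ↦ absurd (J 0).2 (Finset.notMem_empty _) }
  -- a metric on `M`
  letI : TopologicalSpace.MetrizableSpace M := Manifold.metrizableSpace 𝓘(ℝ, E) M
  letI : MetricSpace M := TopologicalSpace.metrizableSpaceMetric M
  -- a finite atlas and a Lebesgue number `3η`
  obtain ⟨t, ht⟩ : ∃ t : Finset M, (univ : Set M) ⊆ ⋃ p ∈ t, (chartAt E p).source :=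
    isCompact_univ.elim_finite_subcover (fun p : M ↦ (chartAt E p).source)
      (fun p ↦ (chartAt E p).open_source) fun x _ ↦ mem_iUnion.2 ⟨x, mem_chart_source E x⟩
  have htne : t.Nonempty := by
    obtain ⟨x⟩ := hM
    obtain ⟨p, hp, -⟩ := mem_iUnion₂.1 (ht (mem_univ x))
    exact ⟨p, hp⟩
  obtain ⟨lam, hlam, hleb⟩ := lebesgue_number_lemma_of_metric (ι := ↥t)
    (c := fun p ↦ (chartAt E (p : M)).source) isCompact_univ (fun p ↦ (chartAt E (p : M)).open_source)
    (fun x _ ↦ by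
      obtain ⟨p, hp, hx⟩ := mem_iUnion₂.1 (ht (mem_univ x))
      exact mem_iUnion.2 ⟨⟨p, hp⟩, hx⟩)
  haveI : Nonempty ↥t := htne.coe_sort
  choose! jt hjt using hleb
  set j : M → M := fun x ↦ (jt x : M) with hj
  have hjmem : ∀ x, j x ∈ t := fun x ↦ (jt x).2
  have hjball : ∀ x, ball x lam ⊆ (chartAt E (j x)).source := fun x ↦ hjt x (mem_univ x)
  set η := lam / 3 with hη
  have hηpos : 0 < η := by positivity
  have hηlam : η ≤ lam := by rw [hη]; linarith
  -- the compact cores `Q p = {z | B_d(z, η) ⊆ source_p}`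
  set Q : M → Set M := fun p ↦ {z | ∀ w, w ∉ (chartAt E p).source → η ≤ dist z w} with hQ
  have hQclosed : ∀ p, IsClosed (Q p) := fun p ↦ by
    simp only [hQ, setOf_forall]
    exact isClosed_iInter fun w ↦ isClosed_iInter fun _ ↦
      isClosed_le continuous_const (continuous_id.dist continuous_const)
  have hQcpt : ∀ p, IsCompact (Q p) := fun p ↦ (hQclosed p).isCompact
  have hQball : ∀ p z, z ∈ Q p ↔ ball z η ⊆ (chartAt E p).source := fun p z ↦ by
    constructor
    · intro hz w hw
      by_contra hws
      have h := hz w hws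
      rw [mem_ball, dist_comm] at hw
      exact absurd hw (not_lt.2 h)
    · intro hz w hws
      by_contra hlt
      exact hws (hz (by rw [mem_ball, dist_comm]; exact not_le.1 hlt))
  have hQsrc : ∀ p, Q p ⊆ (chartAt E p).source := fun p z hz ↦
    (hQball p z).1 hz (mem_ball_self hηpos)
  -- (a) uniform continuity of `ψ_p⁻¹` near `ψ_p (Q p)`: radii `r₁ p`
  have stepA : ∀ p : M, ∃ r₁ > 0, ∀ z ∈ Q p, ∀ r, r ≤ r₁ →
      (∀ v ∈ ball (echart E p z) r, (ιE).symm v ∈ (chartAt E p).target) ∧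
        eball E p z r ⊆ ball z η := by
    intro p
    set T := (ιE).symm ⁻¹' (chartAt E p).target with hT
    have hTo : IsOpen T := (chartAt E p).open_target.preimage (ιE).symm.continuous
    set K := echart E p '' Q p with hK
    have hψc : ContinuousOn (echart E p) (chartAt E p).source :=
      (ιE).continuous.comp_continuousOn (chartAt E p).continuousOn
    have hKc : IsCompact K := (hQcpt p).image_of_continuousOn (hψc.mono (hQsrc p))
    have hKT : K ⊆ T := by
      rintro _ ⟨z, hz, rfl⟩
      show (ιE).symm (ιE (chartAt E p z)) ∈ (chartAt E p).target
      rw [ContinuousLinearEquiv.symm_apply_apply]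
      exact (chartAt E p).map_source (hQsrc p hz)
    obtain ⟨δ, hδ, hCT⟩ := hKc.exists_cthickening_subset_open hTo hKT
    have hCc : IsCompact (cthickening δ K) := hKc.cthickening
    have hFc : ContinuousOn (echartInv E p) T :=
      (chartAt E p).continuousOn_symm.comp (ιE).symm.continuous.continuousOn fun v hv ↦ hv
    have hFu := hCc.uniformContinuousOn_of_continuous (hFc.mono hCT)
    obtain ⟨r₀, hr₀, hr₀u⟩ := Metric.uniformContinuousOn_iff.1 hFu η hηpos
    refine ⟨min r₀ δ, lt_min hr₀ hδ, fun z hz r hr ↦ ?_⟩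
    have hzK : echart E p z ∈ K := ⟨z, hz, rfl⟩
    have hballC : ∀ v ∈ ball (echart E p z) r, v ∈ cthickening δ K := fun v hv ↦
      closedBall_subset_cthickening hzK δ
        (mem_closedBall.2 ((mem_ball.1 hv).le.trans (hr.trans (min_le_right _ _))))
    refine ⟨fun v hv ↦ hCT (hballC v hv), fun x hx ↦ ?_⟩
    have hxv : echart E p x ∈ ball (echart E p z) r := hx.2
    have hd := hr₀u (echart E p x) (hballC _ hxv) (echart E p z)
      (self_subset_cthickening K hzK) ((mem_ball.1 hxv).trans_le (hr.trans (min_le_left _ _)))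
    rw [echartInv_echart hx.1, echartInv_echart (hQsrc p hz)] at hd
    exact mem_ball.2 hd
  choose r₁ hr₁pos hr₁ using stepA
  -- (b) convexity of transported balls: radii `ρ p q`
  have stepB : ∀ p q : M, ∃ ρ > 0, ∀ c ∈ echart E p '' (Q p ∩ Q q), ∀ r, 0 < r → r ≤ ρ →
      ball c r ⊆ edom E p q ∧ Convex ℝ (etrans E p q '' ball c r) := by
    intro p q
    have hψc : ContinuousOn (echart E p) (chartAt E p).source :=
      (ιE).continuous.comp_continuousOn (chartAt E p).continuousOn
    have hKc : IsCompact (echart E p '' (Q p ∩ Q q)) :=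
      ((hQcpt p).inter_right (hQclosed q)).image_of_continuousOn
        (hψc.mono (inter_subset_left.trans (hQsrc p)))
    have hKD : echart E p '' (Q p ∩ Q q) ⊆ edom E p q := by
      rintro _ ⟨z, hz, rfl⟩
      rw [mem_edom_iff]
      refine ⟨?_, ?_⟩
      · show (ιE).symm (ιE (chartAt E p z)) ∈ (chartAt E p).target
        rw [ContinuousLinearEquiv.symm_apply_apply]
        exact (chartAt E p).map_source (hQsrc p hz.1)
      · rw [echartInv_echart (hQsrc p hz.1)]
        exact hQsrc q hz.2
    have h2 : (2 : WithTop ℕ∞) ≤ ∞ := by decide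
    exact exists_radius_convex_image_ball (isOpen_edom p q) (isOpen_edom q p)
      ((contDiffOn_etrans p q).of_le h2) ((contDiffOn_etrans q p).of_le h2) (mapsTo_etrans p q)
      (mapsTo_etrans q p) (fun x hx ↦ etrans_etrans hx) (fun y hy ↦ etrans_etrans hy) hKc hKD
  choose ρ hρpos hρ using stepB
  -- one radius `rr` below all `r₁ p` (`p ∈ t`) and all `ρ p q` (`p, q ∈ t`)
  set rr := min (t.inf' htne r₁) ((t ×ˢ t).inf' (htne.product htne) fun pq ↦ ρ pq.1 pq.2) with hrr
  have hrrpos : 0 < rr := by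
    refine lt_min ((Finset.lt_inf'_iff _).2 fun p _ ↦ hr₁pos p)
      ((Finset.lt_inf'_iff _).2 fun pq _ ↦ hρpos pq.1 pq.2)
  have hrr₁ : ∀ p ∈ t, rr ≤ r₁ p := fun p hp ↦
    (min_le_left _ _).trans (Finset.inf'_le _ hp)
  have hrrρ : ∀ p ∈ t, ∀ q ∈ t, rr ≤ ρ p q := fun p hp q hq ↦
    (min_le_right _ _).trans (Finset.inf'_le (fun pq : M × M ↦ ρ pq.1 pq.2)
      (Finset.mk_mem_product hp hq))
  -- the balls `W x = B(x; j x, rr)` and a finite subcover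
  set W : M → Set M := fun x ↦ eball E (j x) x rr with hW
  have hWo : ∀ x, IsOpen (W x) := fun x ↦ isOpen_eball _ _ _
  have hxQ : ∀ x, x ∈ Q (j x) := fun x ↦ (hQball _ _).2 ((ball_subset_ball hηlam).trans (hjball x))
  have hxW : ∀ x, x ∈ W x := fun x ↦ mem_eball (hQsrc _ (hxQ x)) hrrpos
  have hWsmall : ∀ x, W x ⊆ ball x η := fun x ↦
    (hr₁ (j x) x (hxQ x) rr (hrr₁ _ (hjmem x))).2
  obtain ⟨s, hs⟩ := isCompact_univ.elim_finite_subcover W hWo fun x _ ↦ mem_iUnion.2 ⟨x, hxW x⟩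
  refine ⟨s, ⟨{ U := fun i ↦ W i.1, isOpen := fun i ↦ hWo i.1, iUnion_eq := ?_, exists_chart := ?_ }⟩⟩
  · refine eq_univ_of_forall fun x ↦ ?_
    obtain ⟨i, hi, hx⟩ := mem_iUnion₂.1 (hs (mem_univ x))
    exact mem_iUnion.2 ⟨⟨i, hi⟩, hx⟩
  · intro n J hne
    obtain ⟨z₀, hz₀⟩ := hne
    have hz₀k : ∀ k, z₀ ∈ W (J k).1 := fun k ↦ mem_cechSet_iff.1 hz₀ k
    set x₀ : M := (J 0).1 with hx₀
    set p : M := j x₀ with hp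
    have hpt : p ∈ t := hjmem x₀
    -- every member lies `η`-close to `x₀`, hence has its centre in `Q p`
    have hcentre : ∀ k, (J k).1 ∈ Q p := fun k ↦ by
      rw [hQball]
      refine Subset.trans ?_ (hjball x₀)
      intro w hw
      rw [mem_ball] at hw ⊢
      have h1 : dist z₀ (J k).1 < η := mem_ball.1 (hWsmall _ (hz₀k k))
      have h2 : dist z₀ x₀ < η := mem_ball.1 (hWsmall _ (hz₀k 0))
      calc dist w x₀ ≤ dist w (J k).1 + dist (J k).1 z₀ + dist z₀ x₀ := dist_triangle4 _ _ _ _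
        _ < η + η + η := by rw [dist_comm (J k).1 z₀]; gcongr
        _ = lam := by rw [hη]; ring
    -- hence (b) applies to the ball of `(J k).1` in its own chart `q = j (J k).1`, read in chart `p`
    have hkey : ∀ k, W (J k).1 ⊆ (chartAt E p).source ∧
        Convex ℝ (chartAt E p '' W (J k).1) := fun k ↦ by
      set y : M := (J k).1 with hy
      set q : M := j y with hq
      have hcK : echart E q y ∈ echart E q '' (Q q ∩ Q p) := ⟨y, ⟨hxQ y, hcentre k⟩, rfl⟩
      obtain ⟨hBD, hconv⟩ := hρ q p (echart E q y) hcK rr hrrpos (hrrρ q (hjmem y) p hpt)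
      obtain ⟨hsub, himg⟩ := eball_subset_source_and_image (E := E) hBD
      refine ⟨hsub, ?_⟩
      rw [image_chartAt_eq, himg]
      exact convex_image_symm hconv
    refine ⟨p, ⋂ k, chartAt E p '' W (J k).1, ?_, ?_, ?_, ?_⟩
    · exact isOpen_iInter_of_finite fun k ↦
        (chartAt E p).isOpen_image_of_subset_source (hWo _) (hkey k).1
    · exact convex_iInter fun k ↦ (hkey k).2
    · exact (iInter_subset _ 0).trans (image_subset_iff.2 fun x hx ↦ (chartAt E p).map_source ((hkey 0).1 hx))
    · rw [chartSet_self_eq, preimage_iInter, inter_iInter]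
      refine iInter_congr fun k ↦ ?_
      exact eq_source_inter_preimage_image (hkey k).1

/-- **de Rham's theorem, numerical form, for compact manifolds**: for every compact Hausdorff
`C^∞` manifold `M` modelled on a finite-dimensional real normed space `E` (model `𝓘(ℝ, E)`, no
boundary) and every `k`, `dim_ℝ H^k_dR(M; ℝ) = b_k(M; ℝ)` — the named fact
`finrank_deRhamCohomology_eq_bettiNumber 𝓘(ℝ, E) M k` HOLDS (de Rham 1931; Weil 1952; Bott–Tu
(1982), Thm. 8.9, Thm. 15.8, Thm. 5.1). [cite: BottTu1982Forms, Thm. 8.9, Thm. 15.8] -/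
theorem finrank_deRhamCohomology_eq_bettiNumber_of_compactSpace [IsManifold 𝓘(ℝ, E) ∞ M]
    [T2Space M] [CompactSpace M] (k : ℕ) : finrank_deRhamCohomology_eq_bettiNumber 𝓘(ℝ, E) M k := by
  obtain ⟨s, ⟨𝒰⟩⟩ := exists_chartConvexCover (E := E) (M := M)
  exact finrank_deRhamCohomology_eq_bettiNumber_of_chartConvexCover 𝒰 k

end Literature.NumberTheory.Transcendental
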